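import Summits.CriticalPhenomena.PercolationContinuityZ3.Theorems.PercNearOneGluingNoHeavyLowerTailSunflowerGradedSafeBlocks
import Summits.CriticalPhenomena.PercolationContinuityZ3.Theorems.PercNearOneGluingNoHeavyLowerTailSunflowerBlowup
import Summits.CriticalPhenomena.PercolationContinuityZ3.Theorems.PercNearOneGluingNoHeavyLowerTailSunflowerUnionEdgeAnalytic
import Summits.CriticalPhenomena.PercolationContinuityZ3.Theorems.PercNearOneGluingNoHeavyLowerTailSunflowerUnionEdgeAnalyticZero
import HarnessLib

/-!
# `NoHeavyLowerTail` (crux stmt-CriticalPhenomena-4575), abstract sunflower cubic: SAFETY IS PRESERVED BY ADDING A DISJOINT EDGE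
# (the first closure of A-safety under disjoint unions: an A-safe graph plus complete bipartite components is A-safe)

Support file (seat `prim-ineq-prove-1` gen 43; `--supports stmt-CriticalPhenomena-4575`).  No `sorry`, no named facts.
Memo: run/shared/lean/prim/prim-ineq-prove-1/FINDING-COSTGAME-prove1-g43.md §5.

SETTING (`…SunflowerSafeCalculus`, `…SunflowerGradedSafeBlocks`).  `μ = prodBernoulli p` on `Set ι` (`ι` finite); `Safe p A`
= Lemma A in product form for every finite family of up-sets meeting pairwise inside `A`.  The classes of safe cores known so
far are closed under conjunction on disjoint blocks (`safe_inter`), OR-substitution of fresh blocks (`safe_preimage_orMap`, blow-ups),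
induced subgraphs / contraction minors (`…SunflowerSafeMinors`) — but NOT known to be closed under DISJUNCTION on disjoint blocks
(the disjoint union of graphs); memo FINDING-BLOWUP-prove1-g42.md §3.1 lists this as open.  This file proves the first case:
* **`safe_union_pair`**: if `A` is an up-set determined by the coordinates other than `y₁ ≠ y₂` and `Safe p A`, then
  `Safe p (A ∪ {ω | y₁ ∈ ω ∧ y₂ ∈ ω})` — adding the disjoint "edge" `y₁ ∧ y₂` preserves safety, at every `p`.
  PROOF.  Condition on the four states of `(y₁, y₂)` (`real_eq_BEx` on the block `{y₁, y₂}`, `BEx_pair`): with `x, u, v, m` the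
  measures of the sections of a petal `V ⊇ core` at the states `11, 10, 01, 00`, `μ(V) = st·x + s(1−t)u + (1−s)t·v + (1−s)(1−t)m`,
  `m ≤ min(u, v)`, `u, v ∈ [μ A, 1]`; the `10`-sections (and the `01`-sections) of the petals meet pairwise inside `A`, so `Safe p A`
  bounds `∏ u_j`, `∏ v_j` by `μ(A)^(K−1)` (and the pairwise products by `μ A`, Harris); the two-coin bound of
  `…SunflowerUnionEdgeAnalytic` (`two_coin_prod_le`, merging the petals one at a time through the 2-merge inequality; `_zero` when
  `μ A = 0`) gives `∏ μ(V_j) ≤ (st + (1−st)μ A)^(K−1) = μ(A ∪ {y₁y₂})^(K−1)`.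
* GRAPH FORM: `edgeCore_sup_edge` (`edgeCore (Γ₀ ⊔ edge y₁y₂) = edgeCore Γ₀ ∪ {y₁, y₂ open}`), `determinedBy_edgeCore_of_isolated`,
  **`safe_edgeCore_add_edge`** (if `y₁, y₂` are isolated in `Γ₀` and `edgeCore Γ₀` is safe at `p` then so is the core of `Γ₀` plus
  the edge `y₁y₂`), **`aSafe_edgeCore_add_edge_comap`** (hence every BLOW-UP of `Γ₀ + y₁y₂` is A-safe when `Γ₀` is: an A-safe
  graph plus a disjoint complete bipartite component `K_{m,n}` is A-safe, `aSafe_edgeCore_comap` of `…SunflowerBlowup`).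
  Iterating: an A-safe graph plus any number of disjoint complete bipartite components is A-safe (e.g. `C₅ ⊔ K₂`, `M₈ ⊔ K_{3,3}`,
  every Andrásfai graph plus complete bipartite components).
REMARKS (memo §5).  (i) The general disjunction `Safe A₁ → Safe A₂ → Safe (A₁ ∨ A₂)` on disjoint blocks is reduced in the memo
to the integrality of the polytope of `K` monotone `[0,1]`-functions on the independence complex of the second graph with
pointwise sum `≤ 1` (verified by LP for all graphs on ≤ 5 vertices; false for non-flag complexes), and stays open.  (ii) The
analogous "two-level one-coordinate" step without the `min`-structure is false (`K = 3`), which is why the lane's coordinate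
inductions failed while the disjoint edge works.
-/

noncomputable section

namespace Summit.CriticalPhenomena.PercolationContinuityZ3.Theorems.SunflowerPartition

namespace SafeCalc

open MeasureTheory Finset
open Literature.Probability.LatticeModels Literature.Probability.Percolation
open TwoGenCore (wmiss)

variable {ι : Type*} [DecidableEq ι] (p : ι → unitInterval)

namespace UnionEdge

/-! ## Block expectation over a pair of coordinates -/

/-- The cylinder weights of the block `{y₁, y₂}`. [this work] -/
theorem wmiss_pair {y₁ y₂ : ι} (hne : y₁ ≠ y₂) :
    wmiss p ({y₁, y₂} : Finset ι) ∅ = (p y₁ : ℝ) * p y₂ ∧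
    wmiss p ({y₁, y₂} : Finset ι) {y₂} = (p y₁ : ℝ) * (1 - p y₂) ∧
    wmiss p ({y₁, y₂} : Finset ι) {y₁} = (1 - (p y₁ : ℝ)) * p y₂ ∧
    wmiss p ({y₁, y₂} : Finset ι) {y₁, y₂} = (1 - (p y₁ : ℝ)) * (1 - p y₂) := by
  have h12 : y₁ ∉ ({y₂} : Finset ι) := by rwa [mem_singleton]
  have hb2 : ({y₁, y₂} : Finset ι) \ {y₂} = {y₁} := by
    rw [insert_sdiff_of_notMem _ h12, sdiff_self]; rfl
  have hb1 : ({y₁, y₂} : Finset ι) \ {y₁} = {y₂} := by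
    rw [insert_sdiff_of_mem _ (mem_singleton_self y₁), sdiff_singleton_eq_erase,
      erase_eq_of_notMem h12]
  unfold wmiss
  refine ⟨?_, ?_, ?_, ?_⟩
  · rw [prod_empty, sdiff_empty, prod_pair hne, one_mul]
  · rw [prod_singleton, hb2, prod_singleton, mul_comm]
  · rw [prod_singleton, hb1, prod_singleton]
  · rw [sdiff_self, prod_pair hne]; simp

/-- **Block expectation over a pair**: `BEx p {y₁,y₂} F = st·F ∅ + s(1−t)·F {y₂} + (1−s)t·F {y₁} + (1−s)(1−t)·F {y₁,y₂}`
(`s = p y₁`, `t = p y₂`; the argument of `F` is the MISSING part of the block). [this work] -/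
theorem BEx_pair {y₁ y₂ : ι} (hne : y₁ ≠ y₂) (F : Finset ι → ℝ) :
    BEx p ({y₁, y₂} : Finset ι) F = (p y₁ : ℝ) * p y₂ * F ∅ + p y₁ * (1 - p y₂) * F {y₂}
      + (1 - p y₁) * p y₂ * F {y₁} + (1 - p y₁) * (1 - p y₂) * F {y₁, y₂} := by
  obtain ⟨w0, w2, w1, w12⟩ := wmiss_pair p hne
  have h12 : y₁ ∉ ({y₂} : Finset ι) := by rwa [mem_singleton]
  have hne' : (∅ : Finset ι) ≠ {y₂} := (singleton_ne_empty y₂).symm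
  have hps : ({y₂} : Finset ι).powerset = {∅, {y₂}} := by
    ext D; rw [mem_powerset, subset_singleton_iff, mem_insert, mem_singleton]
  unfold BEx
  rw [show ({y₁, y₂} : Finset ι) = insert y₁ {y₂} from rfl, sum_powerset_insert h12, hps,
    sum_pair hne', sum_pair hne']
  rw [show insert y₁ (∅ : Finset ι) = {y₁} from rfl, show (insert y₁ {y₂} : Finset ι) = {y₁, y₂} from rfl, w0, w2, w1, w12]
  ring

/-! ## The disjoint edge event and its sections -/

/-- The event "both `y₁` and `y₂` are open". [this work] -/
def pairOpen (y₁ y₂ : ι) : Set (Set ι) := {ω | y₁ ∈ ω ∧ y₂ ∈ ω}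

omit [DecidableEq ι] in
/-- `pairOpen` is an up-set. [this work] -/
theorem isUpperSet_pairOpen (y₁ y₂ : ι) : IsUpperSet (pairOpen y₁ y₂) :=
  fun _ _ hle h => ⟨hle h.1, hle h.2⟩

/-- `pairOpen y₁ y₂` is determined by the block `{y₁, y₂}`. [this work] -/
theorem determinedBy_pairOpen (y₁ y₂ : ι) : DeterminedBy (pairOpen y₁ y₂) (↑({y₁, y₂} : Finset ι) : Set ι) := by
  rw [determinedBy_iff]
  intro ω ω' h
  have k : ∀ y ∈ ({y₁, y₂} : Finset ι), y ∈ ω ↔ y ∈ ω' := fun y hy =>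
    ⟨fun hω => ((Set.ext_iff.1 h y).1 ⟨hω, Finset.mem_coe.2 hy⟩).1,
     fun hω' => ((Set.ext_iff.1 h y).2 ⟨hω', Finset.mem_coe.2 hy⟩).1⟩
  simp only [pairOpen, Set.mem_setOf_eq]
  rw [k y₁ (by simp), k y₂ (by simp)]

/-- Sections of `pairOpen`: everything at the state `11`, nothing at the other three states. [this work] -/
theorem sect_pairOpen {y₁ y₂ : ι} (hne : y₁ ≠ y₂) :
    sect ({y₁, y₂} : Finset ι) ∅ (pairOpen y₁ y₂) = Set.univ ∧
    sect ({y₁, y₂} : Finset ι) {y₂} (pairOpen y₁ y₂) = ∅ ∧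
    sect ({y₁, y₂} : Finset ι) {y₁} (pairOpen y₁ y₂) = ∅ ∧
    sect ({y₁, y₂} : Finset ι) {y₁, y₂} (pairOpen y₁ y₂) = ∅ := by
  have hd := determinedBy_pairOpen y₁ y₂
  refine ⟨sect_eq_univ_of_mem hd ?_, sect_eq_empty_of_not_mem hd ?_, sect_eq_empty_of_not_mem hd ?_,
    sect_eq_empty_of_not_mem hd ?_⟩
  · rw [sdiff_empty]; exact ⟨by simp, by simp⟩
  · intro h; have := h.2; simp at this
  · intro h; have := h.1; simp [hne] at this
  · intro h; have := h.1; simp at this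

/-! ## The main theorem -/

/-- **SAFETY IS PRESERVED BY ADDING A DISJOINT EDGE.**  If `A` is an up-set determined by the coordinates other than
`y₁ ≠ y₂` and `A` is safe at `p`, then `A ∪ {ω | y₁ ∈ ω ∧ y₂ ∈ ω}` is safe at `p`. [this work] -/
theorem safe_union_pair [Fintype ι] {y₁ y₂ : ι} (hne : y₁ ≠ y₂) {A : Set (Set ι)}
    (hd : DeterminedBy A (↑({y₁, y₂} : Finset ι) : Set ι)ᶜ) (hu : IsUpperSet A) (hA : Safe p A) :
    Safe p (A ∪ pairOpen y₁ y₂) := by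
  classical
  intro n V hV hcap
  set b : Finset ι := {y₁, y₂} with hb
  set B : Set (Set ι) := A ∪ pairOpen y₁ y₂ with hB
  have hBup : IsUpperSet B := hu.union (isUpperSet_pairOpen y₁ y₂)
  -- enlarge the petals so that they contain the core
  set W : Fin n → Set (Set ι) := fun i => V i ∪ B with hW
  have hWup : ∀ i, IsUpperSet (W i) := fun i => (hV i).union hBup
  have hWB : ∀ i, B ⊆ W i := fun i => Set.subset_union_right
  have hWcap : ∀ i j, i ≠ j → W i ∩ W j ⊆ B := by
    intro i j hij ω hω
    rcases hω with ⟨h1 | h1, h2 | h2⟩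
    · exact hcap i j hij ⟨h1, h2⟩
    exacts [h2, h1, h1]
  have hmono : ∀ i, (prodBernoulli p).real (V i) ≤ (prodBernoulli p).real (W i) :=
    fun i => measureReal_mono Set.subset_union_left
  -- sections of the core
  obtain ⟨e0, e2, e1, e12⟩ := sect_pairOpen hne
  have hsA : ∀ T : Finset ι, sect b T A = A := fun T => sect_eq_self_of_determinedBy_compl b T hd
  have hB0 : sect b ∅ B = Set.univ := by rw [hB, sect_union, hsA, e0, Set.union_univ]
  have hB2 : sect b {y₂} B = A := by rw [hB, sect_union, hsA, e2, Set.union_empty]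
  have hB1 : sect b {y₁} B = A := by rw [hB, sect_union, hsA, e1, Set.union_empty]
  have hB12 : sect b {y₁, y₂} B = A := by rw [hB, sect_union, hsA, e12, Set.union_empty]
  -- notation
  set s : ℝ := ((p y₁ : unitInterval) : ℝ) with hs
  set t : ℝ := ((p y₂ : unitInterval) : ℝ) with ht
  set a : ℝ := (prodBernoulli p).real A with ha
  have hs0 : 0 ≤ s := (p y₁).2.1
  have hs1 : s ≤ 1 := (p y₁).2.2
  have ht0 : 0 ≤ t := (p y₂).2.1
  have ht1 : t ≤ 1 := (p y₂).2.2
  have ha0 : 0 ≤ a := measureReal_nonneg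
  -- the measure of the core
  have hBval : (prodBernoulli p).real B = s * t + (1 - s * t) * a := by
    rw [real_eq_BEx p b B, BEx_pair p hne, hB0, hB2, hB1, hB12, probReal_univ]; ring
  -- the four section measures of the petals
  set x : Fin n → ℝ := fun i => (prodBernoulli p).real (sect b ∅ (W i)) with hx
  set u : Fin n → ℝ := fun i => (prodBernoulli p).real (sect b {y₂} (W i)) with hudef
  set v : Fin n → ℝ := fun i => (prodBernoulli p).real (sect b {y₁} (W i)) with hvdef
  set m : Fin n → ℝ := fun i => (prodBernoulli p).real (sect b {y₁, y₂} (W i)) with hmdef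
  have hdec : ∀ i, (prodBernoulli p).real (W i) =
      s * t * x i + s * (1 - t) * u i + (1 - s) * t * v i + (1 - s) * (1 - t) * m i := by
    intro i; rw [real_eq_BEx p b (W i), BEx_pair p hne]
  -- bounds
  have hx0 : ∀ i, 0 ≤ x i := fun i => measureReal_nonneg
  have hx1 : ∀ i, x i ≤ 1 := fun i => measureReal_le_one
  have hu1 : ∀ i, u i ≤ 1 := fun i => measureReal_le_one
  have hv1 : ∀ i, v i ≤ 1 := fun i => measureReal_le_one
  have hm0 : ∀ i, 0 ≤ m i := fun i => measureReal_nonneg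
  have hua : ∀ i, a ≤ u i := fun i => by
    have h := sect_mono b {y₂} (hWB i); rw [hB2] at h; exact measureReal_mono h
  have hva : ∀ i, a ≤ v i := fun i => by
    have h := sect_mono b {y₁} (hWB i); rw [hB1] at h; exact measureReal_mono h
  have hmu : ∀ i, m i ≤ u i := fun i =>
    measureReal_mono (sect_anti b (show ({y₂} : Finset ι) ⊆ {y₁, y₂} by simp) (hWup i))
  have hmv : ∀ i, m i ≤ v i := fun i =>
    measureReal_mono (sect_anti b (show ({y₁} : Finset ι) ⊆ {y₁, y₂} by simp) (hWup i))
  -- the `10`-sections and the `01`-sections are petal systems for `A`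
  have hcap2 : ∀ i j, i ≠ j → sect b {y₂} (W i) ∩ sect b {y₂} (W j) ⊆ A := by
    intro i j hij; rw [← sect_inter, ← hB2]; exact sect_mono b {y₂} (hWcap i j hij)
  have hcap1 : ∀ i j, i ≠ j → sect b {y₁} (W i) ∩ sect b {y₁} (W j) ⊆ A := by
    intro i j hij; rw [← sect_inter, ← hB1]; exact sect_mono b {y₁} (hWcap i j hij)
  have hpu : ∏ i, u i ≤ a ^ (n - 1) := hA n (fun i => sect b {y₂} (W i)) (fun i => isUpperSet_sect b _ (hWup i)) hcap2
  have hpv : ∏ i, v i ≤ a ^ (n - 1) := hA n (fun i => sect b {y₁} (W i)) (fun i => isUpperSet_sect b _ (hWup i)) hcap1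
  -- assemble
  have hgoal : ∏ i, (prodBernoulli p).real (W i) ≤ (prodBernoulli p).real B ^ (n - 1) := by
    rw [hBval, prod_congr rfl fun i _ => hdec i]
    rcases ha0.lt_or_eq with hapos | hazero
    · exact two_coin_prod_le hapos hs0 hs1 ht0 ht1 x u v m hx0 hx1 hua hu1 hva hv1 hm0 hmu hmv hpu hpv
    · -- `μ A = 0`: only the pairwise constraints survive (Harris)
      have hu0 : ∀ i, 0 ≤ u i := fun i => measureReal_nonneg
      have hv0 : ∀ i, 0 ≤ v i := fun i => measureReal_nonneg
      have hU2 : ∀ i j, i ≠ j → u i * u j = 0 := by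
        intro i j hij
        have h := prodBernoulli_harris p (isUpperSet_sect b {y₂} (hWup i)) (isUpperSet_sect b {y₂} (hWup j))
          MeasurableSet.of_discrete MeasurableSet.of_discrete
        have h' := (h.trans (measureReal_mono (hcap2 i j hij))).trans_eq hazero.symm
        exact le_antisymm h' (mul_nonneg (hu0 i) (hu0 j))
      have hV2 : ∀ i j, i ≠ j → v i * v j = 0 := by
        intro i j hij
        have h := prodBernoulli_harris p (isUpperSet_sect b {y₁} (hWup i)) (isUpperSet_sect b {y₁} (hWup j))
          MeasurableSet.of_discrete MeasurableSet.of_discrete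
        have h' := (h.trans (measureReal_mono (hcap1 i j hij))).trans_eq hazero.symm
        exact le_antisymm h' (mul_nonneg (hv0 i) (hv0 j))
      rw [← hazero, mul_zero, add_zero]
      exact two_coin_prod_le_zero hs0 hs1 ht0 ht1 x u v m hx0 hx1 hu0 hu1 hv0 hv1 hm0 hmu hmv hU2 hV2
  exact le_trans (prod_le_prod (fun i _ => measureReal_nonneg) fun i _ => hmono i) hgoal

end UnionEdge

/-! ## Graph form: an A-safe graph plus a disjoint edge (or complete bipartite component) is A-safe -/

section Graph

open UnionEdge

omit [DecidableEq ι] in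
/-- The core of `Γ₀` plus the edge `y₁y₂` is the core of `Γ₀` together with "`y₁, y₂` both open". [this work] -/
theorem edgeCore_sup_edge (Γ₀ : SimpleGraph ι) {y₁ y₂ : ι} (hne : y₁ ≠ y₂) :
    edgeCore (Γ₀ ⊔ SimpleGraph.fromEdgeSet {s(y₁, y₂)}) = edgeCore Γ₀ ∪ pairOpen y₁ y₂ := by
  ext ω
  simp only [edgeCore, SimpleGraph.sup_adj, SimpleGraph.fromEdgeSet_adj, Set.mem_singleton_iff, Set.mem_setOf_eq,
    Set.mem_union, pairOpen]
  constructor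
  · rintro ⟨u, v, h | ⟨h, -⟩, hu, hv⟩
    · exact Or.inl ⟨u, v, h, hu, hv⟩
    · rcases Sym2.eq_iff.1 h with ⟨rfl, rfl⟩ | ⟨rfl, rfl⟩
      exacts [Or.inr ⟨hu, hv⟩, Or.inr ⟨hv, hu⟩]
  · rintro (⟨u, v, h, hu, hv⟩ | ⟨h1, h2⟩)
    · exact ⟨u, v, Or.inl h, hu, hv⟩
    · exact ⟨y₁, y₂, Or.inr ⟨rfl, hne⟩, h1, h2⟩

/-- If `y₁, y₂` are isolated in `Γ₀`, its core is determined by the other coordinates. [this work] -/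
theorem determinedBy_edgeCore_of_isolated (Γ₀ : SimpleGraph ι) {y₁ y₂ : ι} (h₁ : ∀ z, ¬ Γ₀.Adj y₁ z)
    (h₂ : ∀ z, ¬ Γ₀.Adj y₂ z) : DeterminedBy (edgeCore Γ₀) (↑({y₁, y₂} : Finset ι) : Set ι)ᶜ := by
  rw [determinedBy_iff]
  have key : ∀ ω ω' : Set ι, ω ∩ (↑({y₁, y₂} : Finset ι) : Set ι)ᶜ = ω' ∩ (↑({y₁, y₂} : Finset ι) : Set ι)ᶜ →
      ω ∈ edgeCore Γ₀ → ω' ∈ edgeCore Γ₀ := by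
    rintro ω ω' h ⟨u, v, huv, hu, hv⟩
    have hu' : u ∉ (↑({y₁, y₂} : Finset ι) : Set ι) := by
      intro hm
      rw [Finset.coe_insert, Finset.coe_singleton, Set.mem_insert_iff, Set.mem_singleton_iff] at hm
      rcases hm with rfl | rfl
      exacts [h₁ v huv, h₂ v huv]
    have hv' : v ∉ (↑({y₁, y₂} : Finset ι) : Set ι) := by
      intro hm
      rw [Finset.coe_insert, Finset.coe_singleton, Set.mem_insert_iff, Set.mem_singleton_iff] at hm
      rcases hm with rfl | rfl
      exacts [h₁ u huv.symm, h₂ u huv.symm]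
    have eu := (Set.ext_iff.1 h u).1 ⟨hu, hu'⟩
    have ev := (Set.ext_iff.1 h v).1 ⟨hv, hv'⟩
    exact ⟨u, v, huv, eu.1, ev.1⟩
  exact fun ω ω' h => ⟨key ω ω' h, key ω' ω h.symm⟩

/-- **An A-safe graph plus a disjoint edge is safe**: if `y₁ ≠ y₂` are isolated in `Γ₀` and `edgeCore Γ₀` is safe at `p`, then the
core of `Γ₀ ⊔ {y₁y₂}` is safe at `p`. [this work] -/
theorem safe_edgeCore_add_edge [Fintype ι] (Γ₀ : SimpleGraph ι) {y₁ y₂ : ι} (hne : y₁ ≠ y₂) (h₁ : ∀ z, ¬ Γ₀.Adj y₁ z)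
    (h₂ : ∀ z, ¬ Γ₀.Adj y₂ z) (hsafe : Safe p (edgeCore Γ₀)) :
    Safe p (edgeCore (Γ₀ ⊔ SimpleGraph.fromEdgeSet {s(y₁, y₂)})) := by
  classical
  rw [edgeCore_sup_edge Γ₀ hne]
  exact safe_union_pair p hne (determinedBy_edgeCore_of_isolated Γ₀ h₁ h₂) (isUpperSet_edgeCore Γ₀) hsafe

/-- **Blow-ups: an A-safe graph plus a disjoint complete bipartite component is A-safe.**  Every pull-back `(Γ₀ ⊔ {y₁y₂}).comap f`
(in particular `Γ₀' ⊔ K_{m,n}` with `Γ₀'` a blow-up of `Γ₀`) has an A-safe core when `Γ₀` has. [this work] -/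
theorem aSafe_edgeCore_add_edge_comap [Fintype ι] {κ : Type*} [Fintype κ] (f : κ → ι) (Γ₀ : SimpleGraph ι) {y₁ y₂ : ι}
    (hne : y₁ ≠ y₂) (h₁ : ∀ z, ¬ Γ₀.Adj y₁ z) (h₂ : ∀ z, ¬ Γ₀.Adj y₂ z)
    (hsafe : ∀ q : ι → unitInterval, Safe q (edgeCore Γ₀)) (p' : κ → unitInterval) :
    Safe p' (edgeCore ((Γ₀ ⊔ SimpleGraph.fromEdgeSet {s(y₁, y₂)}).comap f)) :=
  aSafe_edgeCore_comap f _ (fun q => safe_edgeCore_add_edge q Γ₀ hne h₁ h₂ (hsafe q)) p'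

end Graph

end SafeCalc

end Summit.CriticalPhenomena.PercolationContinuityZ3.Theorems.SunflowerPartition
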